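import Summits.CriticalPhenomena.Ising3DConformalLimit.Theses.AnomalousForcesInteraction
import Summits.CriticalPhenomena.Ising3DConformalLimit.Theorems.AnomalousForcesInteractionEtaPositiveSplitGlue
import HarnessLib

/-!
# Line `regularity-sign` for crux `EtaPositive` (item stmt-CriticalPhenomena-2600) — ALTERNATIVE skeleton (strategist s1)

Registered as an ALTERNATIVE line (never overwrites the live skeleton `Lines/registered.lean`).

Decomposition **regularity × sign** of `EtaPositive : ∃ κ > 0, C, ∀ x ≠ 0, ⟨σ₀σ_x⟩_{β_c(3)} ≤ C‖x‖^{-(1+κ)}`: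

* `stub_etaExists` — the logarithmic exponent `η(3)` EXISTS (`∃ η, HasIsingExponentEta 3 η`; = item stmt-CriticalPhenomena-0635
  verbatim, shared with `IsingEuclidUpgrade` r3 and the `FilmLadder` target; on THIS route it is free given the rank-4 crux
  `MoebiusLimit` by the landed `limitExists_of_moebiusLimit` + `HasPointwiseScalingLimit.exists_isingEta`). No sign information.
* `stub_etaGainIO` — a power GAIN over the infrared bound at ARBITRARILY FAR sites (`∀ N ∃ x, ‖x‖ > N ∧ ⟨σ₀σ_x⟩ ≤ C‖x‖^{-(1+κ)}`).
  No regularity information; strictly weaker than the crux (`SplitGlue.etaGainIO_of_etaPositive`) and, unconditionally,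
  EXACTLY `¬ HasIsingExponentEta 3 0` (`SplitGlue.etaGainIO_iff_not_hasIsingExponentEta_zero`, p169603) — the negation of the
  canonical branch `η_log = 0`. This is the load-bearing stub and the natural OUTPUT FORMAT of regular-scale / random-current
  technology (statements at infinitely many good scales).
* `EtaPositive_of : EtaPositive` — the route decl BY NAME from the two stubs through the landed glue
  `SplitGlue.etaPositive_of_etaExists_of_etaGainIO` (p169603): the two stubs force `κ ≤ η`, so `η > 0`, so the crux with exponent `η/2`.

Why it dodges the STUCK goal of the live line (`stub_isothermGain`, `1/δ > 1/5` in upper-bound form, open in print even for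
any `b > 0`): no field-sector / one-arm / thermal exponent is asked for; the uniform-in-`x` demand of the crux is moved into the
regularity stub (an existing shared item with its own producers), and what remains is an `i.o.` statement a proof may establish
along ANY sequence of scales of its choosing (e.g. ADC21-regular scales), by contradiction from two-sided saturation
`⟨σ₀σ_x⟩ = ‖x‖^{-1+o(1)}`.
-/

namespace Summit.CriticalPhenomena.Ising3DConformalLimit.Cruxes.EtaPositive.RegularitySign

/-- **stub_etaExists** (OPEN; = item stmt-CriticalPhenomena-0635): the anomalous dimension `η(3)` exists in the logarithmic
sense `log⟨σ₀σ_x⟩_{β_c}/log‖x‖ → −(1+η)` (cofinite filter on `ℤ³`). [cite: DuminilCopinICM2022 §4.1, §9 (open);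
DuminilCopinPanis2025LowerBounds Thm 1.5] -/
theorem stub_etaExists : ∃ η : ℝ, Literature.Probability.LatticeModels.HasIsingExponentEta 3 η := by
  sorry

/-- **stub_etaGainIO** (OPEN; load-bearing; ⟺ `¬ HasIsingExponentEta 3 0` unconditionally): some power gain `κ > 0` over the
infrared bound `⟨σ₀σ_x⟩ ≤ C‖x‖⁻¹` occurs at sites of arbitrarily large sup norm. [cite: DuminilCopinPanis2025LowerBounds §1
(d = 3: only 0 ≤ η ≤ 1 known), Thm 1.3; AizenmanDuminilCopinAnnals2021 Thm 4.13 (regular scales)] -/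
theorem stub_etaGainIO : ∃ κ C : ℝ, 0 < κ ∧ ∀ N : ℕ, ∃ x : Literature.Probability.LatticeModels.Site 3, (N : ℝ) < ‖x‖ ∧ Literature.Probability.LatticeModels.criticalTwoPoint 3 x ≤ C * (‖x‖ : ℝ) ^ (-(1 + κ)) := by
  sorry

/-- **Skeleton theorem (the composition BY NAME).** The crux `EtaPositive` of route `AnomalousForcesInteraction` from
the two declared stubs `stub_etaExists` and `stub_etaGainIO`, through the LANDED sorry-free glue
`SplitGlue.etaPositive_of_etaExists_of_etaGainIO` (p169603; hypothesis form
`(statement of stub_etaExists) → (statement of stub_etaGainIO) → (definiens of EtaPositive)`: the stubs force `κ ≤ η`,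
so `η > 0`, so the crux with exponent `η/2`). -/
theorem EtaPositive_of :
    Summit.CriticalPhenomena.Ising3DConformalLimit.Theses.AnomalousForcesInteraction.EtaPositive :=
  Summit.CriticalPhenomena.Ising3DConformalLimit.Cruxes.EtaPositive.SplitGlue.etaPositive_of_etaExists_of_etaGainIO
    stub_etaExists stub_etaGainIO

end Summit.CriticalPhenomena.Ising3DConformalLimit.Cruxes.EtaPositive.RegularitySign
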